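import Summits.Ventures.Crystal3D.Bulk.GapCensusSkeleton
import Summits.Ventures.Crystal3D.Bulk.HoleForm
import Literature.Geometry.DiscreteGeometry.SphericalCodeContactGraph
import HarnessLib

/-!
# Degree bounds in the GAP census: at most five tight neighbours at a shell ball and at the
# intruder (Musin–Tarasov Prop. 3.3, upper part, two-threshold setting)

HONEST FRAMING. Part of the venture `Summits/Ventures/Crystal3D` (cell `pub-crystal3d`, phase 2,
24-hour sprint `PLAN.md` R42; seat typer-bulk-2). A brick of the census completeness hypothesis
`GapCensus.Complete` (`Bulk/GapCensusSkeleton.lean`, cell file `DESIGN-L12-THEORY.md` P-L2(b),(c)):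
for EVERY admissible fourteen-ball configuration (`IsGapConfig`, no extremality needed)

* a shell ball touches at most FIVE other shell balls (`IsGapConfig.card_shellContacts_le_five`):
  the shell centres recentred at ball `0` are unit vectors pairwise at inner product `≤ 1/2`, the
  ones touching `xᵢ` are at inner product exactly `1/2` with it, and the tree's
  `Literature…SphericalCodeContactGraph.card_le_five_of_neighbours` (Musin–Tarasov 2012, Prop. 3.3:
  at most five neighbours at a fixed level on `S²`) applies with `κ = 1/2`;
* the intruder touches at most FIVE shell balls (`IsGapConfig.card_intruderContacts_le_five`, for
  intruder distance `< 2`): same lemma around the intruder's direction with `κ = D/2 ∈ [1/2, 1)`.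

The sharper census facts (total tight degree of a shell ball `≤ 5` INCLUDING the intruder, and
intruder degree `≤ 4` for hole radius `< 58.28°`) need the corner-angle bounds `α₀ = arccos(1/3)`,
`A_x(ρ)`, `A_p(ρ)` of P-L2 and are NOT proved here. Nothing is claimed about GAP(1.26).
-/

noncomputable section

open scoped BigOperators InnerProductSpace
open Finset

namespace Summit.Ventures.Crystal3D

open Literature.Geometry.DiscreteGeometry

variable {c : Fin 14 → EuclideanSpace ℝ (Fin 3)}

/-! ## The shell as unit vectors around ball `0` -/

/-- Shell centres, recentred at ball `0`, are unit vectors. -/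
theorem IsGapConfig.norm_sub_eq_one (hc : IsGapConfig c) {j : Fin 14} (hj0 : j ≠ 0)
    (hj13 : j ≠ 13) : ‖c j - c 0‖ = 1 := by
  rw [← dist_eq_norm]; exact hc.2 j hj0 hj13

/-- Distinct shell centres, recentred, are at inner product `≤ 1/2` (they are `≥ 1` apart). -/
theorem IsGapConfig.inner_sub_le_half (hc : IsGapConfig c) {j k : Fin 14} (hj0 : j ≠ 0)
    (hj13 : j ≠ 13) (hk0 : k ≠ 0) (hk13 : k ≠ 13) (hjk : j ≠ k) :
    ⟪c j - c 0, c k - c 0⟫_ℝ ≤ 1 / 2 := by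
  rw [← one_le_dist_iff_inner_le_half (hc.norm_sub_eq_one hj0 hj13)
    (hc.norm_sub_eq_one hk0 hk13), dist_sub_right]
  exact hc.1 j k hjk

/-- Touching shell balls, recentred, are at inner product exactly `1/2`. -/
theorem IsGapConfig.inner_sub_eq_half (hc : IsGapConfig c) {j k : Fin 14} (hj0 : j ≠ 0)
    (hj13 : j ≠ 13) (hk0 : k ≠ 0) (hk13 : k ≠ 13) (hd : dist (c j) (c k) = 1) :
    ⟪c j - c 0, c k - c 0⟫_ℝ = 1 / 2 := by
  have hsq : dist (c j - c 0) (c k - c 0) ^ 2 = 2 - 2 * ⟪c j - c 0, c k - c 0⟫_ℝ := by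
    rw [dist_eq_norm, norm_sub_sq_real, hc.norm_sub_eq_one hj0 hj13, hc.norm_sub_eq_one hk0 hk13]
    ring
  rw [dist_sub_right, hd] at hsq
  linarith

/-- Distinct balls of an admissible configuration have distinct centres. -/
theorem IsGapConfig.injective (hc : IsGapConfig c) : Function.Injective c := by
  intro j k hjk
  by_contra hne
  have h := hc.1 j k hne
  rw [hjk, dist_self] at h
  exact absurd h (by norm_num)

/-! ## At most five shell contacts at a shell ball -/

/-- **A shell ball touches at most five other shell balls** (every admissible configuration;
Musin–Tarasov 2012 Prop. 3.3 at level `κ = 1/2` through the tree's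
`card_le_five_of_neighbours`). -/
theorem IsGapConfig.card_shellContacts_le_five (hc : IsGapConfig c) {i : Fin 14} (hi0 : i ≠ 0)
    (hi13 : i ≠ 13) :
    (univ.filter fun j : Fin 14 => j ≠ 0 ∧ j ≠ 13 ∧ j ≠ i ∧ dist (c i) (c j) = 1).card ≤ 5 := by
  classical
  set S := univ.filter fun j : Fin 14 => j ≠ 0 ∧ j ≠ 13 ∧ j ≠ i ∧ dist (c i) (c j) = 1 with hS
  have hinj : Set.InjOn (fun j => c j - c 0) ↑S := fun j _ k _ h =>
    hc.injective (sub_left_injective h)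
  rw [← card_image_of_injOn hinj]
  refine card_le_five_of_neighbours (v := c i - c 0) (hc.norm_sub_eq_one hi0 hi13) (κ := 1 / 2)
    (by norm_num) (by norm_num) ?_ ?_ ?_
  · intro u hu
    obtain ⟨j, hj, rfl⟩ := mem_image.1 hu
    obtain ⟨hj0, hj13, -, -⟩ := (mem_filter.1 hj).2
    exact hc.norm_sub_eq_one hj0 hj13
  · intro u hu
    obtain ⟨j, hj, rfl⟩ := mem_image.1 hu
    obtain ⟨hj0, hj13, -, hd⟩ := (mem_filter.1 hj).2
    exact hc.inner_sub_eq_half hi0 hi13 hj0 hj13 hd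
  · intro u hu w hw huw
    obtain ⟨j, hj, rfl⟩ := mem_image.1 hu
    obtain ⟨k, hk, rfl⟩ := mem_image.1 hw
    obtain ⟨hj0, hj13, -, -⟩ := (mem_filter.1 hj).2
    obtain ⟨hk0, hk13, -, -⟩ := (mem_filter.1 hk).2
    have hjk : j ≠ k := fun h => huw (by rw [h])
    exact hc.inner_sub_le_half hj0 hj13 hk0 hk13 hjk

/-! ## At most five shell contacts at the intruder -/

/-- The intruder is at distance `≥ 1` from ball `0` (it is a member of the packing). -/
theorem IsGapConfig.one_le_intruderDist (hc : IsGapConfig c) : 1 ≤ intruderDist c :=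
  hc.1 0 13 (by decide)

/-- **The intruder touches at most five shell balls** (every admissible configuration with
intruder distance `< 2`; beyond `2` it touches at most one, trivially): around the intruder's
direction `p` the touching shell centres sit at level `κ = D/2 ∈ [1/2, 1)` and are pairwise at
inner product `≤ 1/2 ≤ κ`, so `card_le_five_of_neighbours` applies. The census's sharper
`≤ 4` (hole radius `< 58.28°`) is a corner-angle fact not proved here. -/
theorem IsGapConfig.card_intruderContacts_le_five (hc : IsGapConfig c) (hD : intruderDist c < 2) :
    (univ.filter fun j : Fin 14 => j ≠ 0 ∧ j ≠ 13 ∧ dist (c 13) (c j) = 1).card ≤ 5 := by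
  classical
  set D := intruderDist c with hDdef
  have hD1 : 1 ≤ D := hc.one_le_intruderDist
  have hDpos : 0 < D := by linarith
  -- the intruder's unit direction
  set p : EuclideanSpace ℝ (Fin 3) := D⁻¹ • (c 13 - c 0) with hpdef
  have hnorm13 : ‖c 13 - c 0‖ = D := by rw [← dist_eq_norm, dist_comm]; rfl
  have hp : ‖p‖ = 1 := by
    rw [hpdef, norm_smul, Real.norm_of_nonneg (inv_nonneg.2 hDpos.le), hnorm13,
      inv_mul_cancel₀ hDpos.ne']
  have h13 : c 13 - c 0 = D • p := by
    rw [hpdef, smul_smul, mul_inv_cancel₀ hDpos.ne', one_smul]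
  -- a touching shell ball is at level `D/2`
  have hlevel : ∀ j : Fin 14, j ≠ 0 → j ≠ 13 → dist (c 13) (c j) = 1 →
      ⟪p, c j - c 0⟫_ℝ = D / 2 := by
    intro j hj0 hj13 hd
    have hu := hc.norm_sub_eq_one hj0 hj13
    have hsq : dist (c 13 - c 0) (c j - c 0) ^ 2 = D ^ 2 - 2 * D * ⟪p, c j - c 0⟫_ℝ + 1 := by
      rw [h13, dist_eq_norm, norm_sub_sq_real, norm_smul, Real.norm_of_nonneg hDpos.le, hp, hu,
        real_inner_smul_left]
      ring
    rw [dist_sub_right, hd] at hsq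
    have : 2 * D * ⟪p, c j - c 0⟫_ℝ = D * D := by nlinarith [hsq]
    field_simp
    nlinarith [this, hDpos]
  set S := univ.filter fun j : Fin 14 => j ≠ 0 ∧ j ≠ 13 ∧ dist (c 13) (c j) = 1 with hS
  have hinj : Set.InjOn (fun j => c j - c 0) ↑S := fun j _ k _ h =>
    hc.injective (sub_left_injective h)
  rw [← card_image_of_injOn hinj]
  refine card_le_five_of_neighbours (v := p) hp (κ := D / 2) (by linarith) (by linarith) ?_ ?_ ?_
  · intro u hu
    obtain ⟨j, hj, rfl⟩ := mem_image.1 hu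
    obtain ⟨hj0, hj13, -⟩ := (mem_filter.1 hj).2
    exact hc.norm_sub_eq_one hj0 hj13
  · intro u hu
    obtain ⟨j, hj, rfl⟩ := mem_image.1 hu
    obtain ⟨hj0, hj13, hd⟩ := (mem_filter.1 hj).2
    exact hlevel j hj0 hj13 hd
  · intro u hu w hw huw
    obtain ⟨j, hj, rfl⟩ := mem_image.1 hu
    obtain ⟨k, hk, rfl⟩ := mem_image.1 hw
    obtain ⟨hj0, hj13, -⟩ := (mem_filter.1 hj).2
    obtain ⟨hk0, hk13, -⟩ := (mem_filter.1 hk).2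
    have hjk : j ≠ k := fun h => huw (by rw [h])
    exact (hc.inner_sub_le_half hj0 hj13 hk0 hk13 hjk).trans (by linarith)

end Summit.Ventures.Crystal3D

end
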